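import Summits.QuantumFields.YangMills.Theorems.UnitScaleTiltHalvingP1FlatCoreTopSizes
import HarnessLib

/-!
# `hP1room` PROGRAMME (LEAD-H «H = hSupU» BOARD v2, RULING L-10 [R-h]): ★★★ THE DOOR's `hsize` BLOCK FROM PROPOSITION 3 AT THE TOP, AT THE H-LINE MEMBER, IN ONE CALL
# — companion of ✓`HalvingP1FlatCoreTopSizes` (§1 `prop3_sizes_top`, §2 `levelCubeSizes_of_prop3_top`), read at `d = 3`, `L := (F.P K).L`, `k := K − n`, `η := L^{−(K−n)}`, `M₂(ℂ)`,
# flat background, and composed with ✓`HalvingP1FlatCoreWindowSizes.hsize_of_windowSizes`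

Route `UnitScaleTilt`, crux K1 child «MinimiserStabilityRegPr» (stmt-QuantumFields-19200), registered stub `stub_halvingStep` (`BirthV10`), text
`hP1room ⟸ hSupU ⟸` the nine content rows of ✓p643656 `HalvingP1FlatCoreSupplierDoor.hSup_of_contentRows`; THIS FILE serves row [R-h] (`hX1`∕`hX2`) as the `hsize` block.
Cell `ym3-torus` (HUMAN RULING D-0037: YM₃ on T³ is ladder rung R3 — NOT d = 4, NOT a mass gap, NOT the Clay problem), width seat `ym-ust-19200-w6` gen 2.
`--supports stmt-QuantumFields-19200 --as helper`; THEOREMS ONLY (0 `def`, 0 `sorry`); count-neutral; nothing here claims `core′`, `hP1room`, `hSupU`, the stub, the crux or the gap.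
HONEST SCOPE.  By-name instantiation (`letI : CStarAlgebra (Matrix (Fin 2) (Fin 2) ℂ) := {}` inside the proof, the tree's idiom); every analytic row stays DISPLAYED exactly as in
N05's files ((1.33)∕(1.34) `InAk`, level-`k` (1.42) `H42` ⟸ (W1), level-`k` (1.59) `H59`, the windows at `α₂ = 2Lc⋆ + 8α₄`, the datum's a priori chart row [R-h]-a).

References: T. Bałaban, CMP **99** (1985) 75–102 [Balaban1985RegularSpaces] (Prop. 3 p.87, (1.62) p.87, (1.36) p.82, (1.40)–(1.42) p.83); CMP **102** (1985) 277–309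
[Balaban1985Variational] ((144) p.300, (152) p.301, p.286).
-/

set_option autoImplicit false

noncomputable section

open scoped BigOperators Matrix.Norms.L2Operator
open NormedSpace

namespace Summit.QuantumFields.YangMills.Theorems.HalvingP1FlatCoreTopSizes

open Literature.MathematicalPhysics.QuantumFieldTheory.Balaban1983to89
open Literature.MathematicalPhysics.QuantumFieldTheory.Balaban1983to89.T3ContinuumYM3Torus
open MatrixLog B7Prop1Explicit B7Prop2Explicit B7Prop1Local B7Eq92Concrete
open B7Prop1Explicit renaming Site → LSite
open B8Lemma1NonAbelian (mulCfg)
open B8Ineq132 (covDerivFwd InAk)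
open B8Eq140Level (SideTouches)
open B8Eq119TwistedAxial (Restr129)
open B8Eq184Proof (cfgExp)
open B8Eq146AExpansion (iEta)
open B7Prop4GeneralLevels (logCovIter linCovIter)
open B8Eq155JBound (Jcur wsup)
open B8ScaledSupNorm (bondNorm msup)
open B7Prop3Flat (c3)
open B8Eq131Cubes (cube gs)
open B5Eq118OneStroke (iterBlockOf)
open B10Eq27TorusAxialLog (rel)
open B15Eq112TorusCover (lift)
open FlatCubeOpsText (IsLevWeight)
open FlatCubeSequenceAligned (cubeSeqMT3 cubeSetM)
open HalvingP1FlatCoreWindowSizes (hsize_of_windowSizes)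

/-! ## §3 The door's `hsize` at the H-line member -/

variable {F : T3Family} {n K : ℕ}

open Classical in
/-- ★★★ **THE DOOR's `hsize` BLOCK FROM PROPOSITION 3 AT THE TOP, IN ONE CALL** (the H-line member: `d = 3`, `L := (F.P K).L`, `k := K − n`, `η := L^{−(K−n)}`, `M₂(ℂ)`, flat
background): §2 ∘ ✓`HalvingP1FlatCoreWindowSizes.hsize_of_windowSizes`, constant `B₁ε₀ := c⋆ = 5·3·L·B₀·(α₀ + α₁)`.  Displayed, exactly as in N05's files: (1.33) of `1`,
(1.34) of the member field `U′`, the level-`k` (1.42) clause `H42` (⟸ (W1) `…TopH42`), the level-`k` (1.59) in-edge `H59`, the windows at `α₂ = 2Lc⋆ + 8α₄`, and the datum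
`(u, W, X)` with its a priori chart row ([R-h]-a). [cite: Balaban1985RegularSpaces, Prop. 3 (1.62) p.87, (1.36) p.82; Balaban1985Variational, (144) p.300, (152) p.301, p.286] -/
theorem hsize_of_prop3_top (hnK : n < K) (x₀ : Site (F.P K) 0) (ρ S M : ℕ) (hM : 1 ≤ M) (hS : 2 ≤ S)
    {a : LSite (F.P K).d} {M' ρ' : ℕ} (h0 : ρ + M ≤ ρ' + 1) (h1 : (F.P K).L + S + M ≤ ρ' + 2)
    (ha : ∀ ν, a ν ≤ ((iterBlockOf (K - n) x₀ ν).val : ℤ) ∧ ((iterBlockOf (K - n) x₀ ν).val : ℤ) ≤ a ν + M' - 1)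
    (hroomW : 2 * ((F.P K).L ^ (K - n) * (M' + 1) + ρ' * gs (F.P K).L (K - n)) ≤ (F.P K).sitesPerDir 0)
    (hL : 2 ≤ (F.P K).L)
    {U' : LSite (F.P K).d → Fin (F.P K).d → (Matrix (Fin 2) (Fin 2) ℂ)ˣ} (hU' : ∀ x κ, U' x κ ∈ unitaryUnits (Matrix (Fin 2) (Fin 2) ℂ))
    {α₀ α₁ α₄ B₀ cstar : ℝ} (hα₀ : 0 < α₀) (hα₁ : 0 ≤ α₁) (hα₄ : 0 ≤ α₄) (hB₀ : 0 ≤ B₀)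
    (hc : cstar = 5 * (F.P K).d * (F.P K).L * B₀ * (α₀ + α₁))
    (hα3 : C0 (F.P K).d * α₀ ≤ 1 / 3) (hα4 : 4 * α₀ ≤ c2' (F.P K).d (F.P K).L)
    (h16 : 16 * (2 * ((F.P K).L * cstar) + 8 * α₄) ≤ 1) (hd5 : 5 * (2 * ((F.P K).L * cstar) + 8 * α₄) * (((F.P K).d : ℝ) - 1) ≤ 4)
    (hsmall : Real.exp (4 * (800 * (((F.P K).d : ℝ) + 1) ^ 2 * (((F.P K).d : ℝ) + 4)) * α₀)
      * (1 + 8 * (131072 * (((F.P K).d : ℝ) + 1) ^ 2) * (2 * ((F.P K).L * cstar) + 8 * α₄)) ≤ 2)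
    (hc₃ : 2 * (2 * ((F.P K).L * cstar) + 8 * α₄) ≤ c3 (F.P K).d (F.P K).L)
    (hside : 36 * (F.P K).d * B₀ * (2 * ((F.P K).L * cstar) + 8 * α₄) ≤ 1 / 2)
    (h50 : 50 * (F.P K).d * (2 * ((F.P K).L * cstar) + 8 * α₄) ≤ 1)
    {C₂ : ℝ} (hC₂ : 8 * (131072 * (((F.P K).d : ℝ) + 1) ^ 2) *
      Real.exp (4 * (800 * (((F.P K).d : ℝ) + 1) ^ 2 * (((F.P K).d : ℝ) + 4)) * α₀) ≤ C₂)
    (h61 : 2 * (2 * ((F.P K).L * cstar) + 8 * α₄) ^ 2 + 20 * (F.P K).d * α₀ * (2 * ((F.P K).L * cstar) + 8 * α₄)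
      + 2 * C₂ * (2 * ((F.P K).L * cstar) + 8 * α₄) ^ 2 ≤ α₀ + α₁)
    (Ω : ℕ → Set (LSite (F.P K).d)) (Λs : ℕ → ℕ → Set (LSite (F.P K).d)) (Λb : ℕ → ℕ → Set (LSite (F.P K).d × Fin (F.P K).d))
    (hbox : ∀ j, j ≤ K - n → ∀ c ∈ Λb (K - n) j, ∀ x, InBox (loK (F.P K).L j c.1) (bondHiK (F.P K).L j c.1 c.2) x → x ∈ Ω j)
    (hΩ : ∀ j, j ≤ K - n → cube (F.P K).L a M' ρ' (K - n) j ⊆ Ω j)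
    (h33 : InAk (F.P K).L (K - n) (((F.L : ℝ)⁻¹) ^ (K - n)) α₀ Ω (1 : LSite (F.P K).d → Fin (F.P K).d → (Matrix (Fin 2) (Fin 2) ℂ)ˣ))
    (h34 : InAk (F.P K).L (K - n) (((F.L : ℝ)⁻¹) ^ (K - n)) α₀ Ω
      (mulCfg U' (1 : LSite (F.P K).d → Fin (F.P K).d → (Matrix (Fin 2) (Fin 2) ℂ)ˣ)))
    (Lan : ℕ → (LSite (F.P K).d → Fin (F.P K).d → (Matrix (Fin 2) (Fin 2) ℂ)ˣ) → Prop)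
    (H42 : ∀ (u : LSite (F.P K).d → (Matrix (Fin 2) (Fin 2) ℂ)ˣ) (W : LSite (F.P K).d → Fin (F.P K).d → (Matrix (Fin 2) (Fin 2) ℂ)ˣ)
        (A' : LSite (F.P K).d → Fin (F.P K).d → Matrix (Fin 2) (Fin 2) ℂ),
      (∀ x, u x ∈ unitaryUnits (Matrix (Fin 2) (Fin 2) ℂ)) →
      mgauge (1 : LSite (F.P K).d → Fin (F.P K).d → (Matrix (Fin 2) (Fin 2) ℂ)ˣ) u W = U' →
      Restr129 (F.P K).L (K - n) (Λs (K - n)) (1 : LSite (F.P K).d → Fin (F.P K).d → (Matrix (Fin 2) (Fin 2) ℂ)ˣ) u → Lan (K - n) W →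
      (∀ y τ, IsSelfAdjoint (A' y τ)) →
      (∀ j, j ≤ K - n → ∀ y τ, SideTouches (Ω j) y τ →
        W y τ = cfgExp (((F.L : ℝ)⁻¹) ^ (K - n)) A' y τ ∧
          ‖A' y τ‖ ≤ (2 * ((F.P K).L * cstar) + 8 * α₄) * (((F.P K).L : ℝ) ^ j * ((F.L : ℝ)⁻¹) ^ (K - n))⁻¹) →
      (∀ y τ, (∀ j, j ≤ K - n → ¬ SideTouches (Ω j) y τ) → A' y τ = 0) →
      ∀ j, j ≤ K - n → ∀ c ∈ Λb (K - n) j,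
        ‖logCovIter (F.P K).L (1 : LSite (F.P K).d → Fin (F.P K).d → (Matrix (Fin 2) (Fin 2) ℂ)ˣ)
          (iEta (((F.L : ℝ)⁻¹) ^ (K - n)) A') j c.1 c.2‖ < 2 * (F.P K).d * (F.P K).L * α₁)
    (H59 : ∀ (u : LSite (F.P K).d → (Matrix (Fin 2) (Fin 2) ℂ)ˣ) (W : LSite (F.P K).d → Fin (F.P K).d → (Matrix (Fin 2) (Fin 2) ℂ)ˣ)
        (A' : LSite (F.P K).d → Fin (F.P K).d → Matrix (Fin 2) (Fin 2) ℂ),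
      (∀ x, u x ∈ unitaryUnits (Matrix (Fin 2) (Fin 2) ℂ)) →
      mgauge (1 : LSite (F.P K).d → Fin (F.P K).d → (Matrix (Fin 2) (Fin 2) ℂ)ˣ) u W = U' →
      Restr129 (F.P K).L (K - n) (Λs (K - n)) (1 : LSite (F.P K).d → Fin (F.P K).d → (Matrix (Fin 2) (Fin 2) ℂ)ˣ) u → Lan (K - n) W →
      (∀ y τ, IsSelfAdjoint (A' y τ)) →
      (∀ j, j ≤ K - n → ∀ y τ, SideTouches (Ω j) y τ →
        W y τ = cfgExp (((F.L : ℝ)⁻¹) ^ (K - n)) A' y τ ∧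
          ‖A' y τ‖ ≤ (2 * ((F.P K).L * cstar) + 8 * α₄) * (((F.P K).L : ℝ) ^ j * ((F.L : ℝ)⁻¹) ^ (K - n))⁻¹) →
      (∀ y τ, (∀ j, j ≤ K - n → ¬ SideTouches (Ω j) y τ) → A' y τ = 0) →
      msup (F.P K).L (K - n) (((F.L : ℝ)⁻¹) ^ (K - n)) (-(1 : ℝ)) (fun j (b : LSite (F.P K).d × Fin (F.P K).d) => SideTouches (Ω j) b.1 b.2)
          (fun b => A' b.1 b.2)
          ≤ B₀ * (bondNorm (F.P K).L (K - n) (((F.L : ℝ)⁻¹) ^ (K - n)) (-(3 : ℝ)) Ω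
              (fun x μ => Jcur (((F.L : ℝ)⁻¹) ^ (K - n)) (1 : LSite (F.P K).d → Fin (F.P K).d → (Matrix (Fin 2) (Fin 2) ℂ)ˣ) A' μ x)
            + wsup 1 (fun p : {p : ℕ × (LSite (F.P K).d × Fin (F.P K).d) // p.1 ≤ K - n ∧ p.2 ∈ Λb (K - n) p.1} =>
                linCovIter (F.P K).L (1 : LSite (F.P K).d → Fin (F.P K).d → (Matrix (Fin 2) (Fin 2) ℂ)ˣ)
                  (iEta (((F.L : ℝ)⁻¹) ^ (K - n)) A') p.1.1 p.1.2.1 p.1.2.2)) ∧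
        msup (F.P K).L (K - n) (((F.L : ℝ)⁻¹) ^ (K - n)) (-(2 : ℝ))
            (fun j (t : Fin (F.P K).d × Fin (F.P K).d × LSite (F.P K).d) => SideTouches (Ω j) t.2.2 t.2.1)
            (fun t => covDerivFwd (((F.L : ℝ)⁻¹) ^ (K - n)) (1 : LSite (F.P K).d → Fin (F.P K).d → (Matrix (Fin 2) (Fin 2) ℂ)ˣ) t.1
              (fun z => A' z t.2.1) t.2.2)
          ≤ B₀ * (bondNorm (F.P K).L (K - n) (((F.L : ℝ)⁻¹) ^ (K - n)) (-(3 : ℝ)) Ω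
              (fun x μ => Jcur (((F.L : ℝ)⁻¹) ^ (K - n)) (1 : LSite (F.P K).d → Fin (F.P K).d → (Matrix (Fin 2) (Fin 2) ℂ)ˣ) A' μ x)
            + wsup 1 (fun p : {p : ℕ × (LSite (F.P K).d × Fin (F.P K).d) // p.1 ≤ K - n ∧ p.2 ∈ Λb (K - n) p.1} =>
                linCovIter (F.P K).L (1 : LSite (F.P K).d → Fin (F.P K).d → (Matrix (Fin 2) (Fin 2) ℂ)ˣ)
                  (iEta (((F.L : ℝ)⁻¹) ^ (K - n)) A') p.1.1 p.1.2.1 p.1.2.2)))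
    (u : LSite (F.P K).d → (Matrix (Fin 2) (Fin 2) ℂ)ˣ) (W : LSite (F.P K).d → Fin (F.P K).d → (Matrix (Fin 2) (Fin 2) ℂ)ˣ)
    (X : LSite (F.P K).d → Fin (F.P K).d → Matrix (Fin 2) (Fin 2) ℂ)
    (hu : ∀ x, u x ∈ unitaryUnits (Matrix (Fin 2) (Fin 2) ℂ))
    (hW : mgauge (1 : LSite (F.P K).d → Fin (F.P K).d → (Matrix (Fin 2) (Fin 2) ℂ)ˣ) u W = U')
    (h129 : Restr129 (F.P K).L (K - n) (Λs (K - n)) (1 : LSite (F.P K).d → Fin (F.P K).d → (Matrix (Fin 2) (Fin 2) ℂ)ˣ) u) (hLan : Lan (K - n) W)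
    (hWX : ∀ j, j ≤ K - n → ∀ y τ, SideTouches (Ω j) y τ →
      W y τ = cfgExp (((F.L : ℝ)⁻¹) ^ (K - n)) X y τ ∧
        ‖X y τ‖ ≤ (2 * ((F.P K).L * cstar) + 8 * α₄) * (((F.P K).L : ℝ) ^ j * ((F.L : ℝ)⁻¹) ^ (K - n))⁻¹) :
    ∀ wt : ℕ → PBond (F.P K) 0 → ℝ, IsLevWeight F n K (cubeSeqMT3 F n K x₀ ρ S M hM) wt →
      (∀ b : PBond (F.P K) 0, wt 1 b *
        ‖(fun b : PBond (F.P K) 0 => if b.src ∈ cubeSetM x₀ (K - n) ρ S M 0 ∧ b.tgt ∈ cubeSetM x₀ (K - n) ρ S M 0 then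
          X (lift (F.P K) x₀ + rel x₀ b.src) b.dir else 0) b‖ ≤ cstar) ∧
      (∀ (b : PBond (F.P K) 0) (ν' : Fin (F.P K).d), wt 2 b * (F.L : ℝ) ^ (K - n) *
        ‖(fun b : PBond (F.P K) 0 => if b.src ∈ cubeSetM x₀ (K - n) ρ S M 0 ∧ b.tgt ∈ cubeSetM x₀ (K - n) ρ S M 0 then
            X (lift (F.P K) x₀ + rel x₀ b.src) b.dir else 0) ⟨b.src.shift ν', b.dir⟩ -
          (fun b : PBond (F.P K) 0 => if b.src ∈ cubeSetM x₀ (K - n) ρ S M 0 ∧ b.tgt ∈ cubeSetM x₀ (K - n) ρ S M 0 then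
            X (lift (F.P K) x₀ + rel x₀ b.src) b.dir else 0) b‖ ≤ cstar) := by
  letI : CStarAlgebra (Matrix (Fin 2) (Fin 2) ℂ) := {}
  have hd2 : 2 ≤ (F.P K).d := by rw [T3Family.P_d]; norm_num
  have hL0 : (0 : ℝ) < F.L := by exact_mod_cast (F.P K).L_pos
  have hη : (0 : ℝ) < ((F.L : ℝ)⁻¹) ^ (K - n) := by positivity
  have hFL : ((F.P K).L : ℝ) = (F.L : ℝ) := rfl
  have hcstar : 0 ≤ cstar := by rw [hc]; positivity
  obtain ⟨hX1, hX2⟩ := levelCubeSizes_of_prop3_top hd2 hη hL (K - n) hU' hα₀ hα₁ hα₄ hB₀ hc hα3 hα4 h16 hd5 hsmall hc₃ hside h50 hC₂ h61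
    Ω Λs Λb hbox h33 h34 Lan H42 H59 u W X hu hW h129 hLan hWX hΩ
  refine hsize_of_windowSizes hnK x₀ ρ S M hM hS h0 h1 ha hroomW X hcstar (fun j hj z hz ν => ?_) (fun j hj z hz ν ν' hz' => ?_)
  · have h := hX1 j hj z hz ν
    rwa [hFL] at h
  · have h := hX2 j hj z hz ν ν' hz'
    rwa [hFL, inv_pow, inv_inv, ← inv_pow] at h

end Summit.QuantumFields.YangMills.Theorems.HalvingP1FlatCoreTopSizes

end
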